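import Summits.CriticalPhenomena.CardyFormulaZ2.Theorems.CardyComplexConeEdgeCoherenceStubFactorisationOrbit

/-!
# Stub `stub_factorisation` of line `Sketch` (composition `FixedRadiusCut`), crux `CardyComplexCone.EdgeCoherence`
(item stmt-CriticalPhenomena-11385) — helper module 3/4: first entry and the first-excursion identity

Helper file `--supports stmt-CriticalPhenomena-11385` (module 3 of 4 of the proof of `stub_factorisation`).

Contents (everything proved), for admissible `E` and a ball `B(v, ρ)` satisfying the interior hypothesis,
with `β = E.bcBondConfig ω`, orbit `o` from `startCorner E`, entry time `t₀ = entryTime ρ v o`: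
* before and at `t₀` the orbit is outside the ball (`not_inBall_of_le_entryTime`); the entry step follows
  an open cut edge (`entry_step`);
* **first excursion = inner hit** (`firstExcursion_iff_innerHit`): on the event "in the ball at time
  `t₀ + 1`", for every `n`, `o (t₀+n) = (v,c) ∧ FirstExcursion ρ v o (t₀+n)` iff
  `InnerHit ρ M ẽ c n` for the quenched translated configuration `M = mixCfg ρ β̃ (ω - v)` and the centred
  entry corner `ẽ` (the coupled inner orbit of module 1 + the status transfer of module 2); on it the phase
  factorises, `orbitPhase β c₀ (t₀+n) = orbitPhase β c₀ t₀ · orbitPhase M ẽ n`, `n < hitBound ρ` and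
  `t₀ + n + 1 < len`;
* the **pathwise first-excursion identity** (`firstExcursion_sum_eq`): the first-excursion phase sum equals
  `[A] · orbitPhase β c₀ t₀ · (integrand of innerResp at the centred label)`, `A` the entry event of
  `entryWeight`;
* the centred label ranges in a finite set of labels with entry vertex outside the ball
  (`entryLabel_mem`, `labelSet_finite`); comparison of entry times along agreeing orbit prefixes
  (`entryTime_le_of_agree`); locality of `mixCfg` under translation (`mixCfg_translate_inter`);
  finiteness of the inner–inner pairs (`innerPairs_finite`).

Sources: H. Duminil-Copin, S. Smirnov, Clay Math. Proc. 15 (2012) §8 (spin-`1/3` observable, `q = 1`);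
S. Smirnov, C. R. Acad. Sci. Paris 333 (2001) §2.
-/

noncomputable section

namespace Summit.CriticalPhenomena.CardyFormulaZ2.Cruxes.EdgeCoherence.FixedRadiusCut

open scoped BigOperators Topology
open Filter Set MeasureTheory ProbabilityTheory
open Literature.Probability.LatticeModels Literature.Probability.RandomPlanarGeometry
open Literature.Probability.Percolation

/-! ## §5 Pathwise: first entry, the coupled inner orbit, the first-excursion identity -/

section Pathwise

open Summit.CriticalPhenomena.CardyFormulaZ2.Theorems.EdgeCoherence.Negative (dartPhaseSum)

variable {E : DiscreteDobrushin} (hE : E.IsZdAdmissible) {v : Site 2} {ρ : ℕ}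
  (hgeo : ∀ x y : Site 2, (∀ i, |x i - v i| ≤ ρ + 2) → (∀ i, |y i - v i| ≤ ρ + 2) →
      (zdGraph 2).Adj x y → (discreteDomainGraph E.Ω E.δ).Adj x y)

/-! Local abbreviations (notation only, expanded at parse time): the completed configuration
`𝔅⟦ω⟧`, its orbit `𝔒⟦ω⟧` from the start corner, the entry time `𝔱⟦ω⟧` into `B(v,ρ)`, the
translation `𝔗` by `-v`, the quenched translated configuration `𝔐⟦ω⟧` and the centred entry
corner `𝔢⟦ω⟧`. -/

local notation "𝔅⟦" ω "⟧" => DiscreteDobrushin.bcBondConfig E ω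
local notation "𝔒⟦" ω "⟧" => cornerOrbit (DiscreteDobrushin.bcBondConfig E ω) (startCorner E)
local notation "𝔱⟦" ω "⟧" =>
  entryTime ρ v (cornerOrbit (DiscreteDobrushin.bcBondConfig E ω) (startCorner E))
local notation "𝔗" => BondConfig.relabel (sym2Equiv (Site.shift (-v)))
local notation "𝔐⟦" ω "⟧" =>
  mixCfg ρ ((fun e : Sym2 (Site 2) => Sym2.map (fun x : Site 2 => x - v) e) ''
      (DiscreteDobrushin.bcBondConfig E ω ∩ cutEdgesAt ρ v))
    (BondConfig.relabel (sym2Equiv (Site.shift (-v))) ω)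
local notation "𝔢⟦" ω "⟧" =>
  (Prod.fst (cornerOrbit (DiscreteDobrushin.bcBondConfig E ω) (startCorner E)
      (entryTime ρ v (cornerOrbit (DiscreteDobrushin.bcBondConfig E ω) (startCorner E)))) - v,
    Prod.snd (cornerOrbit (DiscreteDobrushin.bcBondConfig E ω) (startCorner E)
      (entryTime ρ v (cornerOrbit (DiscreteDobrushin.bcBondConfig E ω) (startCorner E)))))

include hE hgeo

/-- Before (and at) the first entry time the orbit is outside the ball: at time `0` it is the
start corner (a boundary site, outside by the interior hypothesis), later by minimality. -/
theorem not_inBall_of_le_entryTime (ω : BondConfig (Site 2)) {m : ℕ} (hm : m ≤ 𝔱⟦ω⟧) :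
    ¬ InBall ρ ((𝔒⟦ω⟧ m).1 - v) := by
  rcases m with _ | k
  · intro h
    have hc₀ := isStartCorner_startCorner hE
    refine not_mem_zdBoundary_of_interior hgeo (x := (startCorner E).1) (fun i => ?_)
      (E.zdArcA_subset_zdBoundary hc₀.mem_zdArcA)
    have := abs_sub_le_of_inBall (x := (startCorner E).1) h i
    rw [abs_le] at this ⊢; constructor <;> omega
  · exact Nat.notMem_of_lt_sInf (show k < 𝔱⟦ω⟧ from by omega)

/-- **The entry step.** If the orbit is in the ball right after the entry time, the entry corner's
target edge was open (followed), and the next corner is the far end of that edge. -/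
theorem entry_step (ω : BondConfig (Site 2)) (hA : InBall ρ ((𝔒⟦ω⟧ (𝔱⟦ω⟧ + 1)).1 - v)) :
    cTgt (𝔒⟦ω⟧ 𝔱⟦ω⟧) ∈ 𝔅⟦ω⟧ ∧
      𝔒⟦ω⟧ (𝔱⟦ω⟧ + 1) = ((𝔒⟦ω⟧ 𝔱⟦ω⟧).1 + cornerUnit ((𝔒⟦ω⟧ 𝔱⟦ω⟧).2 + 1), (𝔒⟦ω⟧ 𝔱⟦ω⟧).2 + 3) := by
  have hout := not_inBall_of_le_entryTime hE hgeo ω (m := 𝔱⟦ω⟧) le_rfl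
  by_cases h : cTgt (𝔒⟦ω⟧ 𝔱⟦ω⟧) ∈ 𝔅⟦ω⟧
  · exact ⟨h, by change nextCorner _ _ = _; rw [nextCorner_of_mem h]⟩
  · exfalso
    apply hout
    have : 𝔒⟦ω⟧ (𝔱⟦ω⟧ + 1) = ((𝔒⟦ω⟧ 𝔱⟦ω⟧).1, (𝔒⟦ω⟧ 𝔱⟦ω⟧).2 + 1) := by
      change nextCorner _ _ = _; rw [nextCorner_of_not_mem h]
    rw [this] at hA
    exact hA

omit hE in
/-- Status agreement between `β = E.bcBondConfig ω` and the quenched translated configuration,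
for every target edge touching the ball (the hypothesis of `cornerOrbit_couple`). -/
theorem agree_mixCfg (ω : BondConfig (Site 2)) (p : Site 2 × Fin 4)
    (hp : ∃ x ∈ cTgt p, InBall ρ (x - v)) : (cTgt p).map (· - v) ∈ 𝔐⟦ω⟧ ↔ cTgt p ∈ 𝔅⟦ω⟧ := by
  have hadj : (zdGraph 2).Adj p.1 (p.1 + cornerUnit (p.2 + 1)) := by
    have := cTgt_mem_edgeSet p
    rwa [cTgt, SimpleGraph.mem_edgeSet] at this
  have htouch : InBall ρ (p.1 - v) ∨ InBall ρ (p.1 + cornerUnit (p.2 + 1) - v) := by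
    rw [cTgt] at hp
    exact (exists_mem_pair (P := fun x => InBall ρ (x - v))).1 hp
  exact map_mem_mixCfg_iff hgeo ω hadj htouch

/-- **First excursion = inner hit, with phase factorisation and bounds.** On the event that the
orbit is in the ball right after its entry time `t₀`, for every `n`: the passage conditions
`orbit (t₀+n) = (v,c) ∧ FirstExcursion (t₀+n)` and `InnerHit` of the coupled quenched orbit at
time `n` coincide; on them the phase splits as (phase at `t₀`) × (inner phase at `n`),
`n < hitBound ρ`, and (if `t₀ + 1 < len`) `t₀ + n + 1 < len`. -/
theorem firstExcursion_iff_innerHit (ω : BondConfig (Site 2)) (c : Fin 4) (n : ℕ)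
    (hA : InBall ρ ((𝔒⟦ω⟧ (𝔱⟦ω⟧ + 1)).1 - v)) :
    ((𝔒⟦ω⟧ (𝔱⟦ω⟧ + n) = (v, c) ∧ FirstExcursion ρ v 𝔒⟦ω⟧ (𝔱⟦ω⟧ + n)) ↔ InnerHit ρ 𝔐⟦ω⟧ 𝔢⟦ω⟧ c n) ∧
    (InnerHit ρ 𝔐⟦ω⟧ 𝔢⟦ω⟧ c n →
      orbitPhase 𝔅⟦ω⟧ (startCorner E) (𝔱⟦ω⟧ + n) =
          orbitPhase 𝔅⟦ω⟧ (startCorner E) 𝔱⟦ω⟧ * orbitPhase 𝔐⟦ω⟧ 𝔢⟦ω⟧ n ∧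
      n < hitBound ρ ∧
      (𝔱⟦ω⟧ + 1 < (medialExploration E ω).length → 𝔱⟦ω⟧ + n + 1 < (medialExploration E ω).length)) := by
  have hc₀ := isStartCorner_startCorner hE
  have hM : ∀ p : Site 2 × Fin 4, (∃ x ∈ cTgt p, InBall ρ (x - v)) →
      ((cTgt p).map (· - v) ∈ 𝔐⟦ω⟧ ↔ cTgt p ∈ 𝔅⟦ω⟧) := agree_mixCfg hgeo ω
  obtain ⟨-, hnext⟩ := entry_step hE hgeo ω hA
  have hout : ¬ InBall ρ ((𝔒⟦ω⟧ 𝔱⟦ω⟧).1 - v) := not_inBall_of_le_entryTime hE hgeo ω le_rfl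
  have hq : ∃ x ∈ cTgt (𝔒⟦ω⟧ 𝔱⟦ω⟧), InBall ρ (x - v) := by
    refine ⟨(𝔒⟦ω⟧ 𝔱⟦ω⟧).1 + cornerUnit ((𝔒⟦ω⟧ 𝔱⟦ω⟧).2 + 1), Sym2.mem_mk_right _ _, ?_⟩
    have h := hA
    rw [hnext] at h
    exact h
  have horb : ∀ m, cornerOrbit 𝔅⟦ω⟧ (𝔒⟦ω⟧ 𝔱⟦ω⟧) m = 𝔒⟦ω⟧ (𝔱⟦ω⟧ + m) := by
    intro m
    induction m with
    | zero => rfl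
    | succ m ih => exact congrArg (nextCorner 𝔅⟦ω⟧) ih
  -- outer stay ↔ first excursion
  have hFE : FirstExcursion ρ v 𝔒⟦ω⟧ (𝔱⟦ω⟧ + n) ↔
      (0 < n ∧ ∀ m, 0 < m → m ≤ n → InBall ρ ((cornerOrbit 𝔅⟦ω⟧ (𝔒⟦ω⟧ 𝔱⟦ω⟧) m).1 - v)) := by
    constructor
    · rintro ⟨h1, h2⟩
      exact ⟨by omega, fun m hm hmn => by rw [horb]; exact h2 (𝔱⟦ω⟧ + m) (by omega) (by omega)⟩
    · rintro ⟨h1, h2⟩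
      refine ⟨by omega, fun m hm hmn => ?_⟩
      have := h2 (m - 𝔱⟦ω⟧) (by omega) (by omega)
      rwa [horb, show 𝔱⟦ω⟧ + (m - 𝔱⟦ω⟧) = m by omega] at this
  have hstay := stay_iff_couple hM hq n
  refine ⟨?_, fun hIH => ?_⟩
  · constructor
    · rintro ⟨hvc, hfe⟩
      obtain ⟨hn, hOE⟩ := hFE.1 hfe
      refine ⟨?_, hstay.1 hOE⟩
      rw [cornerOrbit_couple hM hq n (Or.inl hOE) n (by omega), horb, hvc]
      simp
    · rintro ⟨hhit, hIE⟩
      have hOE := hstay.2 hIE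
      have hcpl := cornerOrbit_couple hM hq n (Or.inl hOE) n (by omega)
      have hn : 0 < n := by
        rcases Nat.eq_zero_or_pos n with rfl | hn
        · exfalso
          apply hout
          have : (𝔒⟦ω⟧ 𝔱⟦ω⟧).1 - v = 0 := congrArg Prod.fst hhit
          rw [this]; exact inBall_zero ρ
        · exact hn
      refine ⟨?_, hFE.2 ⟨hn, hOE⟩⟩
      rw [hcpl, horb, Prod.mk.injEq] at hhit
      exact Prod.ext (sub_eq_zero.1 hhit.1) hhit.2
  · obtain ⟨-, hIE⟩ := hIH
    have hOE := hstay.2 hIE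
    refine ⟨?_, lt_hitBound_of_stay hout hIE, fun hlen => ?_⟩
    · -- phase factorisation
      have hsum := sum_turnSign_couple hM hq n hOE
      simp only [orbitPhase]
      rw [← Complex.exp_add]
      congr 1
      rw [Finset.sum_range_add]
      simp only [horb] at hsum ⊢
      rw [hsum]
      push_cast
      ring
    · refine succ_lt_length_of_forall_isInnerFace hE hc₀ ω fun k hk => ?_
      rcases Nat.lt_or_ge 𝔱⟦ω⟧ k with hlt | hge
      · have hin : InBall ρ ((𝔒⟦ω⟧ k).1 - v) := by
          have := hOE (k - 𝔱⟦ω⟧) (by omega) (by omega)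
          rwa [horb, show 𝔱⟦ω⟧ + (k - 𝔱⟦ω⟧) = k by omega] at this
        exact isInnerFace_of_interior hgeo (x := (𝔒⟦ω⟧ k).1) (fun i => by
          have := abs_sub_le_of_inBall hin i; rw [abs_le] at this ⊢; constructor <;> omega) _
      · exact isInnerFace_of_succ_lt_length hE hc₀ ω (by omega)

omit hE hgeo in
/-- Two truncations of an indicator-weighted sum agree when the indicator forces the index below
both truncation levels. -/
theorem sum_range_ite_eq {P : ℕ → Prop} [DecidablePred P] {f : ℕ → ℂ} {L H : ℕ}
    (h : ∀ n, P n → n < L ∧ n < H) :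
    (∑ n ∈ Finset.range L, if P n then f n else 0) = ∑ n ∈ Finset.range H, if P n then f n else 0 := by
  have key : ∀ K, (∀ n, P n → n < K) → K ≤ L + H →
      (∑ n ∈ Finset.range K, if P n then f n else 0) =
        ∑ n ∈ Finset.range (L + H), if P n then f n else 0 := fun K hK hKle =>
    Finset.sum_subset (Finset.range_subset_range.2 hKle) fun n _ hn =>
      if_neg fun hP => hn (Finset.mem_range.2 (hK n hP))
  rw [key L (fun n hn => (h n hn).1) (by omega), key H (fun n hn => (h n hn).2) (by omega)]

open scoped Classical in
/-- **The first-excursion identity (pathwise).** The phase sum over the passages at `(v, c)` on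
the first excursion into `B(v, ρ)` equals, on the event "in the ball right after the entry time
`t₀`, and `t₀ + 1 < len`", the phase at `t₀` times the inner functional of the coupled quenched
orbit (the integrand of `innerResp` at the centred label), and `0` off that event. -/
theorem firstExcursion_sum_eq (ω : BondConfig (Site 2)) (c : Fin 4) :
    (∑ k ∈ Finset.range ((medialExploration E ω).length - 1),
        if 𝔒⟦ω⟧ k = (v, c) ∧ FirstExcursion ρ v 𝔒⟦ω⟧ k then orbitPhase 𝔅⟦ω⟧ (startCorner E) k else 0) =
      if InBall ρ ((𝔒⟦ω⟧ (𝔱⟦ω⟧ + 1)).1 - v) ∧ 𝔱⟦ω⟧ + 1 < (medialExploration E ω).length then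
        orbitPhase 𝔅⟦ω⟧ (startCorner E) 𝔱⟦ω⟧ *
          ∑ n ∈ Finset.range (hitBound ρ),
            (if InnerHit ρ 𝔐⟦ω⟧ 𝔢⟦ω⟧ c n then orbitPhase 𝔐⟦ω⟧ 𝔢⟦ω⟧ n else 0)
      else 0 := by
  by_cases hA : InBall ρ ((𝔒⟦ω⟧ (𝔱⟦ω⟧ + 1)).1 - v) ∧ 𝔱⟦ω⟧ + 1 < (medialExploration E ω).length
  · rw [if_pos hA]
    obtain ⟨L, hL⟩ : ∃ L, (medialExploration E ω).length - 1 = 𝔱⟦ω⟧ + L :=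
      ⟨(medialExploration E ω).length - 1 - 𝔱⟦ω⟧, by omega⟩
    rw [hL, Finset.sum_range_add]
    have h0 : (∑ k ∈ Finset.range 𝔱⟦ω⟧,
        if 𝔒⟦ω⟧ k = (v, c) ∧ FirstExcursion ρ v 𝔒⟦ω⟧ k then orbitPhase 𝔅⟦ω⟧ (startCorner E) k else 0) = 0 := by
      refine Finset.sum_eq_zero fun k hk => if_neg ?_
      rintro ⟨-, hfe, -⟩
      rw [Finset.mem_range] at hk
      omega
    rw [h0, zero_add, Finset.mul_sum]
    have key := fun n => firstExcursion_iff_innerHit hE hgeo ω c n hA.1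
    have h1 : ∀ n, (if 𝔒⟦ω⟧ (𝔱⟦ω⟧ + n) = (v, c) ∧ FirstExcursion ρ v 𝔒⟦ω⟧ (𝔱⟦ω⟧ + n)
        then orbitPhase 𝔅⟦ω⟧ (startCorner E) (𝔱⟦ω⟧ + n) else 0) =
        orbitPhase 𝔅⟦ω⟧ (startCorner E) 𝔱⟦ω⟧ *
          if InnerHit ρ 𝔐⟦ω⟧ 𝔢⟦ω⟧ c n then orbitPhase 𝔐⟦ω⟧ 𝔢⟦ω⟧ n else 0 := by
      intro n
      obtain ⟨hiff, himp⟩ := key n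
      by_cases hIH : InnerHit ρ 𝔐⟦ω⟧ 𝔢⟦ω⟧ c n
      · rw [if_pos (hiff.2 hIH), if_pos hIH, (himp hIH).1]
      · rw [if_neg (fun h => hIH (hiff.1 h)), if_neg hIH, mul_zero]
    simp only [h1, ← Finset.mul_sum]
    congr 1
    refine sum_range_ite_eq fun n hn => ⟨?_, ((key n).2 hn).2.1⟩
    have := ((key n).2 hn).2.2 hA.2
    omega
  · rw [if_neg hA]
    refine Finset.sum_eq_zero fun k hk => if_neg ?_
    rintro ⟨-, h1, h2⟩
    apply hA
    rw [Finset.mem_range] at hk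
    exact ⟨h2 (𝔱⟦ω⟧ + 1) (by omega) (by omega), by omega⟩

/-- **Range of the centred label.** On the entry event, the centred label lies in the (finite)
set of labels whose pattern consists of lattice edges crossing the cut of `B(0, ρ)` and whose
entry vertex is outside `B(0, ρ)` but adjacent to it. -/
theorem entryLabel_mem (ω : BondConfig (Site 2)) (hA : InBall ρ ((𝔒⟦ω⟧ (𝔱⟦ω⟧ + 1)).1 - v)) :
    entryLabel ρ v 𝔅⟦ω⟧ 𝔒⟦ω⟧ ∈
      {l : BondConfig (Site 2) × (Site 2 × Fin 4) |
        l.1 ⊆ {e | e ∈ (zdGraph 2).edgeSet ∧ e ∈ cutEdgesAt ρ 0} ∧ ¬ InBall ρ l.2.1 ∧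
          ∃ k : Fin 4, InBall ρ (l.2.1 + cornerUnit k)} := by
  refine ⟨?_, not_inBall_of_le_entryTime hE hgeo ω le_rfl, (𝔒⟦ω⟧ 𝔱⟦ω⟧).2 + 1, ?_⟩
  · rintro _ ⟨e', ⟨hβ, hcut⟩, rfl⟩
    have he' : e' ∈ (zdGraph 2).edgeSet :=
      SimpleGraph.edgeSet_subset_edgeSet.2
        ((discreteDomainGraph_le_meshGraph _ _).trans (meshGraph_le_zdGraph _ _))
        (E.bcBondConfig_subset ω hβ)
    induction e' using Sym2.ind with
    | h a b =>
      show Sym2.map (fun x => x - v) s(a, b) ∈ _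
      refine ⟨?_, ?_⟩
      · rw [Sym2.map_mk, SimpleGraph.mem_edgeSet, sub_eq_add_neg, sub_eq_add_neg]
        rw [SimpleGraph.mem_edgeSet] at he'
        exact (zdGraph_adj_shift_iff (-v) a b).2 he'
      · rw [Sym2.map_mk, mk_mem_cutEdgesAt_iff, sub_zero, sub_zero]
        exact mk_mem_cutEdgesAt_iff.1 hcut
  · obtain ⟨-, hnext⟩ := entry_step hE hgeo ω hA
    show InBall ρ ((𝔒⟦ω⟧ 𝔱⟦ω⟧).1 - v + cornerUnit ((𝔒⟦ω⟧ 𝔱⟦ω⟧).2 + 1))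
    rw [sub_add_eq_add_sub]
    have h := hA
    rwa [hnext] at h

omit hE hgeo in
/-- The set of admissible centred labels is finite. -/
theorem labelSet_finite (ρ : ℕ) :
    {l : BondConfig (Site 2) × (Site 2 × Fin 4) |
        l.1 ⊆ {e | e ∈ (zdGraph 2).edgeSet ∧ e ∈ cutEdgesAt ρ 0} ∧ ¬ InBall ρ l.2.1 ∧
          ∃ k : Fin 4, InBall ρ (l.2.1 + cornerUnit k)}.Finite := by
  -- the box of sup-radius `ρ + 1`
  have hB : {x : Site 2 | ∀ i, |x i| ≤ ρ + 1}.Finite := by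
    refine (Set.Finite.pi (t := fun _ : Fin 2 => Set.Icc (-(ρ : ℤ) - 1) (ρ + 1))
      fun _ => Set.finite_Icc _ _).subset fun x hx => ?_
    simp only [Set.mem_pi, Set.mem_univ, forall_true_left, Set.mem_Icc]
    intro i
    have := hx i
    rw [abs_le] at this
    constructor <;> linarith [this.1, this.2]
  have hnb : ∀ x : Site 2, ∀ k : Fin 4, InBall ρ (x + cornerUnit k) → ∀ i, |x i| ≤ ρ + 1 := by
    intro x k hk i
    have h1 := abs_le_of_inBall hk i
    have h2 := abs_cornerUnit_apply_le k i
    simp only [Pi.add_apply] at h1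
    rw [abs_le] at h1 h2 ⊢; constructor <;> omega
  have hC : {e : Sym2 (Site 2) | e ∈ (zdGraph 2).edgeSet ∧ e ∈ cutEdgesAt ρ 0}.Finite := by
    refine ((hB.prod hB).image fun xy : Site 2 × Site 2 => s(xy.1, xy.2)).subset ?_
    rintro e ⟨he, hcut⟩
    induction e using Sym2.ind with
    | h a b =>
      rw [SimpleGraph.mem_edgeSet] at he
      obtain ⟨k, rfl⟩ := exists_eq_add_cornerUnit he
      rw [mk_mem_cutEdgesAt_iff, sub_zero, sub_zero] at hcut
      have ha : ∀ i, |a i| ≤ ρ + 1 := by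
        rcases hcut.1 with h | h
        · intro i; have := abs_le_of_inBall h i; rw [abs_le] at this ⊢; constructor <;> omega
        · exact hnb a k h
      have hb : ∀ i, |(a + cornerUnit k) i| ≤ ρ + 1 := by
        rcases hcut.1 with h | h
        · intro i
          have h1 := abs_le_of_inBall h i
          have h2 := abs_cornerUnit_apply_le k i
          simp only [Pi.add_apply]
          rw [abs_le] at h1 h2 ⊢; constructor <;> omega
        · intro i; have := abs_le_of_inBall h i; rw [abs_le] at this ⊢; constructor <;> omega
      exact ⟨(a, a + cornerUnit k), ⟨ha, hb⟩, rfl⟩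
  refine ((hC.finite_subsets).prod (hB.prod (Set.finite_univ (α := Fin 4)))).subset ?_
  rintro ⟨S, x, k⟩ ⟨hS, -, k', hk'⟩
  exact ⟨hS, hnb x k' hk', Set.mem_univ _⟩

omit hE hgeo in
/-- **The inner functional reads only the inner–inner pairs** (through the translation by `-v`):
quenching with the same frozen pattern, the translated configurations of `ω` and of
`ω ∩ {inner–inner pairs of B(v,ρ)}` give the same `mixCfg`. -/
theorem mixCfg_translate_inter (B : BondConfig (Site 2)) (ω : BondConfig (Site 2)) :
    mixCfg ρ B (𝔗 (ω ∩ {e : Sym2 (Site 2) | ∀ x ∈ e, InBall ρ (x - v)})) = mixCfg ρ B (𝔗 ω) := by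
  ext e
  rw [mem_mixCfg_iff, mem_mixCfg_iff]
  induction e using Sym2.ind with
  | h a b =>
    have key : ∀ ω₀ : BondConfig (Site 2), s(a, b) ∈ 𝔗 ω₀ ↔ s(a + v, b + v) ∈ ω₀ := fun ω₀ => by
      have := mk_add_mem_relabel_shift_iff (-v) ω₀ (a + v) (b + v)
      rwa [add_neg_cancel_right, add_neg_cancel_right] at this
    rw [key, key, Set.mem_inter_iff, Set.mem_setOf_eq, forall_mem_pair, forall_mem_pair,
      add_sub_cancel_right, add_sub_cancel_right]
    tauto

omit hE hgeo in
/-- A sup-norm box of lattice sites is finite. -/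
theorem box_finite (R : ℤ) : {x : Site 2 | ∀ i, |x i| ≤ R}.Finite := by
  refine (Set.Finite.pi (t := fun _ : Fin 2 => Set.Icc (-R) R) fun _ => Set.finite_Icc _ _).subset
    fun x hx => ?_
  simp only [Set.mem_pi, Set.mem_univ, forall_true_left, Set.mem_Icc]
  exact fun i => abs_le.1 (hx i)

omit hE hgeo in
/-- The set of inner–inner pairs of the ball `B(v, ρ)` is finite. -/
theorem innerPairs_finite : {e : Sym2 (Site 2) | ∀ x ∈ e, InBall ρ (x - v)}.Finite := by
  have hB : {x : Site 2 | InBall ρ (x - v)}.Finite := by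
    refine ((box_finite (ρ : ℤ)).image fun y => y + v).subset fun x hx => ?_
    exact ⟨x - v, fun i => abs_le_of_inBall hx i, sub_add_cancel x v⟩
  refine ((hB.prod hB).image fun xy : Site 2 × Site 2 => s(xy.1, xy.2)).subset ?_
  intro e he
  induction e using Sym2.ind with
  | h a b => exact ⟨(a, b), ⟨he a (Sym2.mem_mk_left _ _), he b (Sym2.mem_mk_right _ _)⟩, rfl⟩

end Pathwise

/-! ## Registered glue sub-goal of this module -/

open scoped Classical in
/-- **Glue sub-goal `firstExcursion_pathwise`** (registered on stmt-CriticalPhenomena-11385 for this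
helper module): the pathwise first-excursion identity — under admissibility and the interior hypothesis
for `B(v, ρ)`, the phase sum over the first-excursion passages at `(v, c)` equals, on the entry event of
`entryWeight`, the entry phase times the integrand of `innerResp` at the centred label read on the
translated configuration, and `0` otherwise. -/
theorem firstExcursion_pathwise : ∀ (E : DiscreteDobrushin) (v : Site 2) (ρ : ℕ), E.IsZdAdmissible → (∀ x y : Site 2, (∀ i, |x i - v i| ≤ ρ + 2) → (∀ i, |y i - v i| ≤ ρ + 2) → (zdGraph 2).Adj x y → (discreteDomainGraph E.Ω E.δ).Adj x y) → ∀ (ω : BondConfig (Site 2)) (c : Fin 4), (∑ k ∈ Finset.range ((medialExploration E ω).length - 1), if (cornerOrbit (E.bcBondConfig ω) (startCorner E)) k = (v, c) ∧ FirstExcursion ρ v (cornerOrbit (E.bcBondConfig ω) (startCorner E)) k then orbitPhase (E.bcBondConfig ω) (startCorner E) k else 0) = if InBall ρ (((cornerOrbit (E.bcBondConfig ω) (startCorner E)) (entryTime ρ v (cornerOrbit (E.bcBondConfig ω) (startCorner E)) + 1)).1 - v) ∧ entryTime ρ v (cornerOrbit (E.bcBondConfig ω) (startCorner E)) + 1 <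 (medialExploration E ω).length then orbitPhase (E.bcBondConfig ω) (startCorner E) (entryTime ρ v (cornerOrbit (E.bcBondConfig ω) (startCorner E))) * ∑ n ∈ Finset.range (hitBound ρ), (if InnerHit ρ (mixCfg ρ (entryLabel ρ v (E.bcBondConfig ω) (cornerOrbit (E.bcBondConfig ω) (startCorner E))).1 (BondConfig.relabel (sym2Equiv (Site.shift (-v))) ω)) (entryLabel ρ v (E.bcBondConfig ω) (cornerOrbit (E.bcBondConfig ω) (startCorner E))).2 c n then orbitPhase (mixCfg ρ (entryLabel ρ v (E.bcBondConfig ω) (cornerOrbit (E.bcBondConfig ω) (startCorner E))).1 (BondConfig.relabel (sym2Equiv (Site.shift (-v))) ω)) (entryLabel ρ v (E.bcBondConfig ω) (cornerOrbit (E.bcBondConfig ω) (startCorner E))).2 n else 0) else 0 :=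
  fun _ _ _ hE hgeo ω c => firstExcursion_sum_eq hE hgeo ω c

end Summit.CriticalPhenomena.CardyFormulaZ2.Cruxes.EdgeCoherence.FixedRadiusCut

end
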